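import Literature.NumberTheory.QuadraticForms.DiagonalFormIsotropyAlgebra
import Literature.NumberTheory.QuadraticForms.GlobalSquareTheorem
import Literature.NumberTheory.Automorphic.UnitaryGroupDirectSum
import HarnessLib

/-!
# A ternary quadratic form over a number field represents, rationally, every `v`-adic norm class it meets;
# the rational line frame `T ↦ (a) ⊕ T_H`

Topic `NumberTheory/QuadraticForms`; namespace `Literature.NumberTheory.QuadraticForms.TernaryLineFrame`.  KERNEL only:
proved theorems, no definition, no named fact, no `sorry`.

For a number field `F`, a finite place `v`, a diagonal ternary form `⟨c₀, c₁, c₂⟩` over `F` with `cᵢ ≠ 0`, and `d ∈ F`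
NOT a square in `F_v` (so that `N = {s² - d r²}` is the norm group of the quadratic extension `F_v(√d)/F_v`):

* §1 (algebra over any field) `finSum_one_two` — `(a) ⊕ᶠ H` as an explicit `3 × 3` matrix; **`exists_lineFrame`** — for
  `x` with `x₀ ≠ 0` the explicit frame `P = (x | (-c₁x₁, c₀x₀, 0) | (-c₂x₂, 0, c₀x₀))` of the line `F x` and its
  `⟨c⟩`-orthogonal plane: `ᵗP diag(c) P = (a) ⊕ᶠ H`, `a = Σ cᵢxᵢ²`, `det P = c₀x₀a`, `det H = c₀²x₀²·(c₀c₁c₂)·a`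
  (O'Meara §42: orthogonal splitting `V = Fx ⊥ (Fx)^⊥` of a regular line);
* §2 (local) **`exists_local_vector`** — over `F_v` the form `⟨c⟩` represents an element of the class `-(c₀c₁c₂)·N`:
  the quinary form `⟨c₀, c₁, c₂, Δ, -Δd⟩` (`Δ = c₀c₁c₂`) is isotropic over `F_v` (`u(F_v) ≤ 4`, O'Meara 63:19 = tree
  `diagIsotropic_adicCompletion_of_five_le`), and if its zero has vanishing last two coordinates the ternary form is
  isotropic, hence universal (O'Meara 42:10 = tree `DiagIsotropic.exists_sum_eq`);
* §3 (local–global) **`exists_rational_vector`** / **`exists_rational_normClass`** — `F³` is dense in `F_v³`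
  (`HeightOneSpectrum.denseRange_algebraMap`), the form is continuous and `F_v²` is a neighbourhood of `1` (local square
  theorem, O'Meara 63:1b = tree `isSquare_of_valued_sub_one_lt`, dyadic places included): a rational `x ∈ F³` with
  `x₀ ≠ 0` (after permuting the coordinates) has `Σ c_{σ i} xᵢ² = -Δ·(s² - d r²)·w²`, `(s, r) ≠ 0`, `w ≠ 0`.

These are the quadratic-form steps of the «rational hyperbolic line frame» of a rank-`3` hermitian space at a non-split
place (consumer: `Automorphic/UnitaryGroupRankThreeRationalLineFrame.lean`, route R of the Hodge/COR-CM row IV-4c3); HC_CM is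
proved only modulo the printed citations until rung 0 closes, and nothing of it is asserted here.

## References
* [Omeara1963] O. T. O'Meara, *Introduction to Quadratic Forms*, Grundlehren 117 (1963), §42 (42:4, 42:10), §63 (63:1b, 63:19).
* [Serre1973] J.-P. Serre, *A Course in Arithmetic*, GTM 7 (1973), Ch. IV §1.6 Prop. 3′, §2.2 Thm. 6 (iv).
-/

set_option autoImplicit false

noncomputable section

open NumberField IsDedekindDomain Matrix
open scoped Matrix

namespace Literature.NumberTheory.QuadraticForms.TernaryLineFrame

/-! ## §1 Frame algebra over a field -/

section Algebra

variable {K : Type*} [Field K]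

/-- `(a) ⊕ᶠ H` (the tree's `UnitaryGroup.finSum 1 2`) as an explicit `3 × 3` matrix. [folklore] -/
private theorem finSum_one_two (a p q q' r : K) :
    Literature.NumberTheory.Automorphic.UnitaryGroup.finSum 1 2 !![a] !![p, q; q', r] =
      !![a, 0, 0; 0, p, q; 0, q', r] := by
  ext i j
  fin_cases i <;> fin_cases j <;> rfl

/-- **The rational frame of a regular line of a diagonal ternary form.**  For `c, x ∈ K³` the explicit matrix
`P = (x | (-c₁x₁, c₀x₀, 0) | (-c₂x₂, 0, c₀x₀))` (its last two columns span the `⟨c⟩`-orthogonal of `x` when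
`c₀x₀ ≠ 0`) satisfies `ᵗP · diag(c) · P = (a) ⊕ᶠ H` with `a = Σ cᵢxᵢ²`, `H` symmetric, `det P = c₀x₀·a` and
`det H = c₀²x₀²·(c₀c₁c₂)·a` (orthogonal splitting `V = Kx ⊥ (Kx)^⊥` of a regular line). [cite: Omeara1963, §42 Prop. 42:4] -/
theorem exists_lineFrame (c x : Fin 3 → K) :
    ∃ (P : Matrix (Fin 3) (Fin 3) K) (H : Matrix (Fin 2) (Fin 2) K),
      Pᵀ * diagonal c * P = Literature.NumberTheory.Automorphic.UnitaryGroup.finSum 1 2 !![∑ i, c i * x i ^ 2] H ∧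
      P.det = c 0 * x 0 * ∑ i, c i * x i ^ 2 ∧
      H.det = c 0 ^ 2 * x 0 ^ 2 * (c 0 * c 1 * c 2) * ∑ i, c i * x i ^ 2 ∧ H.IsSymm := by
  refine ⟨!![x 0, -(c 1 * x 1), -(c 2 * x 2); x 1, c 0 * x 0, 0; x 2, 0, c 0 * x 0],
    !![c 0 * c 1 * (c 0 * x 0 ^ 2 + c 1 * x 1 ^ 2), c 0 * c 1 * c 2 * x 1 * x 2;
       c 0 * c 1 * c 2 * x 1 * x 2, c 0 * c 2 * (c 0 * x 0 ^ 2 + c 2 * x 2 ^ 2)], ?_, ?_, ?_, ?_⟩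
  · rw [finSum_one_two, Matrix.mul_assoc]
    ext i j
    fin_cases i <;> fin_cases j <;>
      simp [Matrix.mul_apply, Fin.sum_univ_three] <;> ring
  · rw [Matrix.det_fin_three]
    simp [Fin.sum_univ_three]
    ring
  · rw [Matrix.det_fin_two]
    simp [Fin.sum_univ_three]
    ring
  · refine Matrix.IsSymm.ext fun i j => ?_
    fin_cases i <;> fin_cases j <;> simp

/-- **Permuting an orthogonal basis**: `ᵗ(P ∘ σ) T (P ∘ σ) = (ᵗP T P) ∘ (σ × σ)` for the column permutation
`P.submatrix id σ`; with `ᵗP T P = diag(c)` this is `diag(c ∘ σ)`. [cite: Omeara1963, §41B] -/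
theorem congr_submatrix {n : Type*} [Fintype n] [DecidableEq n] (T P : Matrix n n K) (σ : Equiv.Perm n) :
    (P.submatrix id σ)ᵀ * T * P.submatrix id σ = (Pᵀ * T * P).submatrix σ σ := by
  rw [Matrix.transpose_submatrix, Matrix.submatrix_mul _ _ σ id σ Function.bijective_id,
    Matrix.submatrix_mul _ _ σ id id Function.bijective_id, Matrix.submatrix_id_id]

end Algebra

/-! ## §2 The local step: `⟨c⟩` represents an element of `-(c₀c₁c₂) · N(F_v(√d)ˣ)` over `F_v` -/

section Local

variable (F : Type) [Field F] [NumberField F] (v : HeightOneSpectrum (𝓞 F))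


/-- **`⟨c₀, c₁, c₂⟩` represents over `F_v` an element of the class `-(c₀c₁c₂)·N`**, `N = {s² - d r² ≠ 0}` (`d` a
non-square of `F_v`): the quinary form `⟨c₀, c₁, c₂, Δ, -Δ d⟩`, `Δ = c₀c₁c₂`, is isotropic over `F_v` (63:19); a zero with
`(y₃, y₄) ≠ 0` gives `Σ cᵢzᵢ² = -Δ(y₃² - d y₄²)`, and a zero with `y₃ = y₄ = 0` makes `⟨c⟩` isotropic, hence universal
(42:10), so that it represents `-Δ = -Δ·(1² - d·0²)`. [cite: Omeara1963, §63C Prop. 63:19 p. 170] -/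
theorem exists_local_vector {c : Fin 3 → F} (hc : ∀ i, c i ≠ 0) (d : F) :
    ∃ (z : Fin 3 → (v.adicCompletion F)) (s r : (v.adicCompletion F)), (s ≠ 0 ∨ r ≠ 0) ∧
      ∑ i, (algebraMap F (v.adicCompletion F)) (c i) * z i ^ 2 =
        -((algebraMap F (v.adicCompletion F)) (c 0 * c 1 * c 2)) *
          (s ^ 2 - (algebraMap F (v.adicCompletion F)) d * r ^ 2) := by
  haveI : CharZero (v.adicCompletion F) := charZero_of_injective_algebraMap (algebraMap F _).injective
  haveI : NeZero (2 : (v.adicCompletion F)) := ⟨two_ne_zero⟩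
  set Δ : F := c 0 * c 1 * c 2 with hΔ
  obtain ⟨y, hy0, hy⟩ := diagIsotropic_adicCompletion_of_five_le F v (le_refl 5)
    ![(algebraMap F (v.adicCompletion F)) (c 0), (algebraMap F (v.adicCompletion F)) (c 1),
      (algebraMap F (v.adicCompletion F)) (c 2), (algebraMap F (v.adicCompletion F)) Δ,
      -((algebraMap F (v.adicCompletion F)) Δ * (algebraMap F (v.adicCompletion F)) d)]
  simp only [Fin.sum_univ_five, Matrix.cons_val_zero, Matrix.cons_val_one, Matrix.cons_val] at hy
  by_cases h34 : y 3 = 0 ∧ y 4 = 0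
  · -- the ternary form is isotropic over `F_v`, hence universal
    have hiso : DiagIsotropic (fun i : Fin 3 => (algebraMap F (v.adicCompletion F)) (c i)) := by
      refine ⟨![y 0, y 1, y 2], fun h0 => hy0 ?_, ?_⟩
      · have e0 := congrFun h0 0
        have e1 := congrFun h0 1
        have e2 := congrFun h0 2
        simp only [Matrix.cons_val_zero, Matrix.cons_val_one, Matrix.cons_val, Pi.zero_apply] at e0 e1 e2
        funext k
        fin_cases k
        · exact e0
        · exact e1
        · exact e2
        · exact h34.1
        · exact h34.2
      · rw [h34.1, h34.2] at hy
        simp only [Fin.sum_univ_three, Matrix.cons_val_zero, Matrix.cons_val_one, Matrix.cons_val]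
        linear_combination hy
    obtain ⟨z, hz⟩ := hiso.exists_sum_eq (fun i => (map_ne_zero _).2 (hc i)) (-((algebraMap F (v.adicCompletion F)) Δ))
    exact ⟨z, 1, 0, Or.inl one_ne_zero, by rw [hz]; ring⟩
  · refine ⟨![y 0, y 1, y 2], y 3, y 4, ?_, ?_⟩
    · by_contra h
      push Not at h
      exact h34 h
    · simp only [Fin.sum_univ_three, Matrix.cons_val_zero, Matrix.cons_val_one, Matrix.cons_val]
      linear_combination hy

/-! ## §3 The local–global step: density of `F³` in `F_v³` and the local square theorem -/

/-- **A value of `⟨c⟩` on `F_v³` at a point with `z₀ ≠ 0` is, up to a non-zero square of `F_v`, a value on a RATIONAL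
point `x ∈ F³` with `x₀ ≠ 0`**: `F³` is dense in `F_v³`, the form is continuous, and the squares of `F_vˣ` contain the
neighbourhood `{q : v(q - 1) < v(4)}` of `1` (63:1b, dyadic places included). [cite: Omeara1963, §63A Cor. 63:1b] -/
theorem exists_rational_vector (c : Fin 3 → F) {z : Fin 3 → (v.adicCompletion F)} (hz0 : z 0 ≠ 0)
    (hα : ∑ i, (algebraMap F (v.adicCompletion F)) (c i) * z i ^ 2 ≠ 0) :
    ∃ (x : Fin 3 → F) (w : (v.adicCompletion F)), x 0 ≠ 0 ∧ w ≠ 0 ∧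
      ∑ i, (algebraMap F (v.adicCompletion F)) (c i) * (algebraMap F (v.adicCompletion F)) (x i) ^ 2 =
        (∑ i, (algebraMap F (v.adicCompletion F)) (c i) * z i ^ 2) * w ^ 2 := by
  haveI : CharZero (v.adicCompletion F) := charZero_of_injective_algebraMap (algebraMap F _).injective
  set α : (v.adicCompletion F) := ∑ i, (algebraMap F (v.adicCompletion F)) (c i) * z i ^ 2 with hαdef
  set q : (Fin 3 → (v.adicCompletion F)) → (v.adicCompletion F) :=
    fun y => ∑ i, (algebraMap F (v.adicCompletion F)) (c i) * y i ^ 2 with hq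
  have hqc : Continuous q :=
    continuous_finsetSum _ fun i _ => continuous_const.mul ((continuous_apply i).pow 2)
  have h4α : (4 : (v.adicCompletion F)) * α ≠ 0 := mul_ne_zero (by norm_num) hα
  -- the open set of `y` with `q y ∈ α·(1 + 4𝔪)`, `y₀ ≠ 0`, `q y ≠ 0`
  set U : Set (Fin 3 → (v.adicCompletion F)) :=
    {y | Valued.v (q y - α) < Valued.v ((4 : (v.adicCompletion F)) * α)} ∩ ({y | y 0 ≠ 0} ∩ {y | q y ≠ 0}) with hU
  have hball : IsOpen {u : (v.adicCompletion F) | Valued.v (u - α) < Valued.v ((4 : (v.adicCompletion F)) * α)} := by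
    have h1 := Valued.isOpen_ball (HeightOneSpectrum.adicCompletion F v) (Valued.v.restrict ((4 : (v.adicCompletion F)) * α))
    have h2 : {u : (v.adicCompletion F) | Valued.v (u - α) < Valued.v ((4 : (v.adicCompletion F)) * α)} =
        (fun u => u - α) ⁻¹'
          {u : (v.adicCompletion F) | Valued.v.restrict u < Valued.v.restrict ((4 : (v.adicCompletion F)) * α)} := by
      ext u
      simp only [Set.mem_setOf_eq, Set.mem_preimage, Valuation.restrict_lt_iff]
    rw [h2]
    exact h1.preimage (continuous_sub_right α)
  have hUo : IsOpen U :=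
    (hball.preimage hqc).inter
      ((isOpen_compl_singleton.preimage (continuous_apply 0)).inter (isOpen_compl_singleton.preimage hqc))
  have hzU : z ∈ U := by
    refine ⟨?_, hz0, hα⟩
    change Valued.v (q z - α) < _
    rw [show q z - α = 0 from sub_self _, map_zero]
    exact (Valuation.pos_iff _).2 h4α
  -- a rational point in `U`
  have hdense : DenseRange (Pi.map fun _ : Fin 3 => ((algebraMap F (v.adicCompletion F)) : F → (v.adicCompletion F))) :=
    DenseRange.piMap fun _ => HeightOneSpectrum.denseRange_algebraMap (K := F) v
  obtain ⟨x, hx⟩ := hdense.exists_mem_open hUo ⟨z, hzU⟩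
  obtain ⟨hx1, hx2, hx3⟩ := hx
  change Valued.v (q (Pi.map (fun _ : Fin 3 => ((algebraMap F (v.adicCompletion F)) : F → (v.adicCompletion F))) x) - α) < _ at hx1
  change (Pi.map (fun _ : Fin 3 => ((algebraMap F (v.adicCompletion F)) : F → (v.adicCompletion F))) x) 0 ≠ 0 at hx2
  change q (Pi.map (fun _ : Fin 3 => ((algebraMap F (v.adicCompletion F)) : F → (v.adicCompletion F))) x) ≠ 0 at hx3
  set β : (v.adicCompletion F) :=
    q (Pi.map (fun _ : Fin 3 => ((algebraMap F (v.adicCompletion F)) : F → (v.adicCompletion F))) x) with hβ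
  -- `β / α` is a square
  have hsq : IsSquare (β / α) := by
    refine isSquare_of_valued_sub_one_lt F v ?_
    have hαv : 0 < Valued.v α := (Valuation.pos_iff _).2 hα
    rw [show β / α - 1 = (β - α) * α⁻¹ from by field_simp, map_mul, map_inv₀, mul_inv_lt_iff₀ hαv, ← map_mul]
    exact hx1
  obtain ⟨w, hw⟩ := hsq
  refine ⟨x, w, fun h => hx2 (by simp only [Pi.map_apply, h, map_zero]), fun h => hx3 ?_, ?_⟩
  · rw [h, mul_zero, div_eq_zero_iff] at hw
    exact hw.resolve_right hα
  · have hβ' : β = α * w ^ 2 := by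
      rw [sq, ← hw, mul_div_cancel₀ _ hα]
    have : ∑ i, (algebraMap F (v.adicCompletion F)) (c i) * (algebraMap F (v.adicCompletion F)) (x i) ^ 2 = β := by
      simp only [hβ, hq, Pi.map_apply]
    rw [this, hβ']

/-- **`⟨c₀, c₁, c₂⟩` represents RATIONALLY an element of the class `-(c₀c₁c₂)·N(F_v(√d)ˣ)·F_vˣ²`**, at a point whose
first coordinate (after a permutation `σ` of the three coordinates) is non-zero: `Σᵢ c_{σ i} xᵢ² = -Δ·(s² - d r²)·w²` with
`x ∈ F³`, `x₀ ≠ 0`, `(s, r) ≠ 0`, `w ≠ 0` (`exists_local_vector` + `exists_rational_vector`).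
[cite: Omeara1963, §63C Prop. 63:19 p. 170] [cite: Omeara1963, §63A Cor. 63:1b] -/
theorem exists_rational_normClass {c : Fin 3 → F} (hc : ∀ i, c i ≠ 0) {d : F}
    (hd : ∀ κ : (v.adicCompletion F), κ * κ ≠ (algebraMap F (v.adicCompletion F)) d) :
    ∃ (σ : Equiv.Perm (Fin 3)) (x : Fin 3 → F) (w s r : (v.adicCompletion F)), x 0 ≠ 0 ∧ w ≠ 0 ∧ (s ≠ 0 ∨ r ≠ 0) ∧
      ∑ i, (algebraMap F (v.adicCompletion F)) (c (σ i)) * (algebraMap F (v.adicCompletion F)) (x i) ^ 2 =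
        -((algebraMap F (v.adicCompletion F)) (c 0 * c 1 * c 2)) *
          (s ^ 2 - (algebraMap F (v.adicCompletion F)) d * r ^ 2) * w ^ 2 := by
  obtain ⟨z, s, r, hsr, hz⟩ := exists_local_vector F v hc d
  -- `s² - d r² ≠ 0` since `d` is not a square
  have hn : s ^ 2 - (algebraMap F (v.adicCompletion F)) d * r ^ 2 ≠ 0 := by
    intro h
    rcases eq_or_ne r 0 with hr | hr
    · rw [hr] at hsr h
      have hs : s = 0 := pow_eq_zero_iff (two_ne_zero) |>.1 (by linear_combination h)
      exact (hsr.resolve_right fun h' => h' rfl) hs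
    · exact hd (s / r) (by field_simp; linear_combination h)
  have hΔ : (algebraMap F (v.adicCompletion F)) (c 0 * c 1 * c 2) ≠ 0 :=
    (map_ne_zero _).2 (mul_ne_zero (mul_ne_zero (hc 0) (hc 1)) (hc 2))
  have hα : ∑ i, (algebraMap F (v.adicCompletion F)) (c i) * z i ^ 2 ≠ 0 := by
    rw [hz]
    exact mul_ne_zero (neg_ne_zero.2 hΔ) hn
  -- a non-zero coordinate of `z`, moved to position `0`
  obtain ⟨i, hi⟩ : ∃ i, z i ≠ 0 := by
    by_contra h
    push Not at h
    apply hα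
    simp only [h, zero_pow two_ne_zero, mul_zero, Finset.sum_const_zero]
  set σ : Equiv.Perm (Fin 3) := Equiv.swap 0 i with hσ
  have hz' : ∑ j, (algebraMap F (v.adicCompletion F)) (c (σ j)) * z (σ j) ^ 2 =
      ∑ j, (algebraMap F (v.adicCompletion F)) (c j) * z j ^ 2 :=
    Equiv.sum_comp σ (fun j => (algebraMap F (v.adicCompletion F)) (c j) * z j ^ 2)
  have hz0 : z (σ 0) ≠ 0 := by rwa [hσ, Equiv.swap_apply_left]
  obtain ⟨x, w, hx0, hw, hx⟩ :=
    exists_rational_vector F v (fun j => c (σ j)) (z := fun j => z (σ j)) hz0 (by rw [hz']; exact hα)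
  exact ⟨σ, x, w, s, r, hx0, hw, hsr, by rw [hx, hz', hz]⟩

end Local

end Literature.NumberTheory.QuadraticForms.TernaryLineFrame

end
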